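import Literature.NumberTheory.ComplexMultiplication.EllipticUnits.KatoUnitRepRubinTheta
import HarnessLib

/-!
# `Θ(1; c𝔣, 𝔞) = Θ(Ω/c; L, 𝔞⁻¹L)` for a model lattice `L = Ω·𝔣`: de Shalit's `e_n(𝔞) = Θ(Ω; 𝔭ⁿL, 𝔞)` IS Kato's
# `Θ(1; 𝔣𝔭ⁿ, 𝔞)`, read on the FIXED lattice of the Weierstrass model (de Shalit II.4.9 (23), II.4.2 (6) — proofs only)

Topic `Literature/NumberTheory/ComplexMultiplication/EllipticUnits` (theorems only; no definition, no named fact, no instance).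
De Shalit fixes `L = Ω𝔣` (II.4.2 (6): «Replacing `E` by one of its conjugates, if necessary, we assume `L = Ω𝔣`») and defines the
elliptic units `e_n(𝔞) = Θ(Ω; 𝔭ⁿL, 𝔞)` (II.4.9 (23)); the lane's units are Kato's `Θ(1; 𝔣𝔭ⁿ, 𝔞)` (`IsThetaValueOne`, lattice
`ι(𝔣𝔭ⁿ)`, division point `1`).  By homogeneity (`deShalitTheta_mulLeft`) these are the values of ONE theta function — the one
attached to the model's lattice `L` and `𝔞⁻¹L` — at the division points `Ω/ι(c)` of `L`, `c` a generator of the extra factor: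

* ★ `isThetaValueOne_span_singleton_mul` — for `L.lattice = Ω·ι(𝔣)`, `La.lattice = 𝔞⁻¹L.lattice`, representatives `S`, and
  `c ∈ 𝒪_K ∖ 0`: **`IsThetaValueOne ι (span{c}·𝔣) 𝔞 (Θ(Ω/ι(c); L, La, S))`** — with `c = πⁿ` (`𝔭ⁿ = (πⁿ)`, `h_K = 1`): `e_n(𝔞)` in
  Kato's normalisation is `Θ(Ω/ι(π)ⁿ; L, 𝔞⁻¹L, S) = Θ_alg(ξ(Ω/πⁿ))` (`PeriodPair.deShalitTheta_eq_const_mul_prod_inv_pow`), the value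
  of the algebraic theta function of the MODEL at the primitive `𝔣𝔭ⁿ`-torsion point `ξ(Ω/πⁿ)`;
* `isThetaValueOne_self` — the case `c = 1`: `IsThetaValueOne ι 𝔣 𝔞 (Θ(Ω; L, La, S))` (`e_0(𝔞) = Q(0)`, the constant term of
  de Shalit's `Q`);
* `deShalitTheta_eq_of_span_singleton_mul` — the underlying identity `Θ(1; dL, dLa, dS) = Θ(Ω/ι c; L, La, S)`, `d = ι(c)/Ω`.
Cell `bsd-print-cf2`, seat `bsd-line-cf2c-w4` g13 (B6 (ii-δ), complex-side bookkeeping §2(e) of `B6-BRIDGE-II-VALUES-w4g13.md`);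
no summit statement is proved; BSD is not proved by any of this.

## References
* [deShalit1987] E. de Shalit, *Iwasawa theory of elliptic curves with complex multiplication* (1987), II §4.2 (6), II §4.9 (23), II §2.3 (10).
* [Kato2004Asterisque] K. Kato, Astérisque 295 (2004), §15.5 (the normalisation `Θ(1; 𝔤, 𝔞)`).
-/

noncomputable section

open scoped Classical
open NumberField

namespace Literature.NumberTheory.ComplexMultiplication.EllipticUnits

variable {K : Type} [Field K] (ι : K →+* ℂ) {𝔣 𝔞 : Ideal (𝓞 K)} {L La : PeriodPair} {S : Finset ℂ} {Ω : ℂ}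

/-- The lattice `d·(Ω·ι(𝔣))` with `d = ι(c)/Ω` is `ι(span{c}·𝔣)`. [cite: deShalit1987, II §4.2 (6)] -/
theorem mem_mulLeft_lattice_iff_of_span_singleton_mul (hL : ∀ z : ℂ, z ∈ L.lattice ↔ ∃ a ∈ 𝔣, z = Ω * ι (a : K))
    (hΩ : Ω ≠ 0) {c : 𝓞 K} (hc : c ≠ 0) (z : ℂ) :
    z ∈ (L.mulLeft (ι (c : K) / Ω) (div_ne_zero ((map_ne_zero ι).mpr (by exact_mod_cast hc)) hΩ)).lattice ↔
      ∃ a ∈ Ideal.span {c} * 𝔣, z = ι (a : K) := by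
  have hιc : ι (c : K) ≠ 0 := (map_ne_zero ι).mpr (by exact_mod_cast hc)
  rw [PeriodPair.mem_mulLeft_lattice, hL]
  constructor
  · rintro ⟨a, ha, h⟩
    refine ⟨c * a, Ideal.mem_span_singleton_mul.mpr ⟨a, ha, rfl⟩, ?_⟩
    have hz : z = (ι (c : K) / Ω) * (Ω * ι (a : K)) := by
      rw [← h, ← mul_assoc, mul_inv_cancel₀ (div_ne_zero hιc hΩ), one_mul]
    rw [hz]
    push_cast
    rw [map_mul]
    field_simp
  · rintro ⟨b, hb, rfl⟩
    obtain ⟨a, ha, rfl⟩ := Ideal.mem_span_singleton_mul.mp hb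
    refine ⟨a, ha, ?_⟩
    push_cast
    rw [map_mul]
    field_simp

/-- **`Θ(1; dL, dLa, dS) = Θ(Ω/ι(c); L, La, S)`**, `d = ι(c)/Ω` (homogeneity of degree `0`). [cite: deShalit1987, II §2.3 (10)] -/
theorem deShalitTheta_eq_of_span_singleton_mul (hΩ : Ω ≠ 0) {c : 𝓞 K} (hc : c ≠ 0) (hS0 : (0 : ℂ) ∈ S) :
    (L.mulLeft (ι (c : K) / Ω) (div_ne_zero ((map_ne_zero ι).mpr (by exact_mod_cast hc)) hΩ)).deShalitTheta
        (La.mulLeft (ι (c : K) / Ω) (div_ne_zero ((map_ne_zero ι).mpr (by exact_mod_cast hc)) hΩ))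
        (S.image ((ι (c : K) / Ω) * ·)) 1 =
      L.deShalitTheta La S (Ω / ι (c : K)) := by
  have hιc : ι (c : K) ≠ 0 := (map_ne_zero ι).mpr (by exact_mod_cast hc)
  have h1 : (1 : ℂ) = (ι (c : K) / Ω) * (Ω / ι (c : K)) := by field_simp
  conv_lhs => rw [h1]
  exact PeriodPair.deShalitTheta_mulLeft L La _ hS0 _

/-- ★ **`IsThetaValueOne ι (span{c}·𝔣) 𝔞 (Θ(Ω/ι(c); L, La, S))`**: on the model lattice `L = Ω·ι(𝔣)` with `La = 𝔞⁻¹L` and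
representatives `S`, Kato's theta value `Θ(1; c𝔣, 𝔞)` of the modulus `c𝔣` is the value of the model's theta function at the
division point `Ω/ι(c)`.  With `c = πⁿ`: de Shalit's `e_n(𝔞) = Θ(Ω; 𝔭ⁿL, 𝔞) = Θ(1; 𝔣𝔭ⁿ, 𝔞) = Θ(Ω/πⁿ; L, 𝔞⁻¹L)`.
[cite: deShalit1987, II §4.9 (23), II §4.2 (6)] [cite: Kato2004Asterisque, §15.5] -/
theorem isThetaValueOne_span_singleton_mul (hL : ∀ z : ℂ, z ∈ L.lattice ↔ ∃ a ∈ 𝔣, z = Ω * ι (a : K)) (hΩ : Ω ≠ 0)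
    (hLa : La.lattice = idealInvLattice ι 𝔞 L.lattice) (hS : L.IsLatticeReps La S) {c : 𝓞 K} (hc : c ≠ 0) :
    IsThetaValueOne ι (Ideal.span {c} * 𝔣) 𝔞 (L.deShalitTheta La S (Ω / ι (c : K))) := by
  have hd : ι (c : K) / Ω ≠ 0 := div_ne_zero ((map_ne_zero ι).mpr (by exact_mod_cast hc)) hΩ
  refine ⟨L.mulLeft _ hd, La.mulLeft _ hd, S.image ((ι (c : K) / Ω) * ·),
    mem_mulLeft_lattice_iff_of_span_singleton_mul ι hL hΩ hc, (idealInvLattice_mulLeft hLa _ hd).symm, hS.mulLeft hd, ?_⟩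
  exact (deShalitTheta_eq_of_span_singleton_mul ι hΩ hc hS.zero_mem).symm

/-- **`IsThetaValueOne ι 𝔣 𝔞 (Θ(Ω; L, La, S))`** (`c = 1`): `e_0(𝔞) = Θ(Ω; L, 𝔞) = Θ(1; 𝔣, 𝔞)` — the constant term `Q(0) = P(0)` of
de Shalit's `Q`. [cite: deShalit1987, II §4.9 (23) (n = 0)] [cite: Kato2004Asterisque, §15.5] -/
theorem isThetaValueOne_self (hL : ∀ z : ℂ, z ∈ L.lattice ↔ ∃ a ∈ 𝔣, z = Ω * ι (a : K)) (hΩ : Ω ≠ 0)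
    (hLa : La.lattice = idealInvLattice ι 𝔞 L.lattice) (hS : L.IsLatticeReps La S) :
    IsThetaValueOne ι 𝔣 𝔞 (L.deShalitTheta La S Ω) := by
  have h := isThetaValueOne_span_singleton_mul ι hL hΩ hLa hS (one_ne_zero : (1 : 𝓞 K) ≠ 0)
  have e : Ω / ι ((1 : 𝓞 K) : K) = Ω := by rw [NumberField.RingOfIntegers.coe_eq_algebraMap, map_one, map_one, div_one]
  rwa [Ideal.span_singleton_one, Ideal.top_mul, e] at h

end Literature.NumberTheory.ComplexMultiplication.EllipticUnits
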